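import Literature.NumberTheory.GaloisRepresentations.HeckeCharacterInfinityTypeBaseChangeProofs
import Literature.NumberTheory.EllipticCurves.KatzPAdicLFunctionCMField
import HarnessLib

/-!
# The Katz type of a base-changed Hecke character: `χ ∘ N_{L/K}` has type `kΣ_L + κ_L(1 − c)` for
# the INDUCED `p`-adic CM type (Hsieh 2014 §1.1; Katz 1978: CM types induced along `K ⊆ L`)

Topic `NumberTheory/EllipticCurves` (the Katz–Hsieh CM frame `KatzPAdicLFunctionCMField`);
namespace `Literature.NumberTheory.EllipticCurves.KatzCM`. PROOFS ONLY (no definition, no named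
fact, no `sorry`). Requested by route `BiquadraticEisensteinDescent` of
`Summits/BirchSwinnertonDyer` (crux `EisensteinHeartFlatCMInertBadKPrime`, hypothesis (T) of the
V2 socket `…KatzHsiehSocket.exists_isBaseChangeLine_span_C_mul_eq`: the Katz type of
`λ · χ∘N_{L/K′}` on `L = K_CM·K′`): the generic transport behind it.

For totally complex `K ⊆ L` with `L/K` Galois, an identification `ι : ℚ̄_p ≃ ℂ`, a finite set
`Σ_p` of places of `K` and the FULL PREIMAGE `Σ_{p,L}` of `Σ_p` in `L` (`𝔓 ∈ Σ_{p,L} ↔ 𝔓 ∩ K ∈ Σ_p`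
— the induced CM type `{φ : L → ℂ | φ|_K ∈ Σ}` read `p`-adically):

* `PadicEmbedding.place_comp_algebraMap_eq_under` — the place of `τ ∘ (K → L)` is the restriction
  of the place of `τ : L → ℚ̄_p` (both are `{‖τ(·)‖ < 1}`);
* `KatzCM.inSigma_comp_iff` — `φ ∈ Σ_L ↔ φ|_K ∈ Σ` for the induced datum;
* `KatzCM.katzExponent_induced` — the exponent function `kΣ_L + κ_L(1 − c)` with
  `κ_L(w) = κ(w|_K)` is the pull-back `n ∘ (φ ↦ φ|_K)` of `kΣ + κ(1 − c)`;
* **`KatzCM.HasKatzType.compRelNorm`** — if `χ` has Katz type `kΣ + κ(1 − c)` then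
  `χ.compRelNorm L = χ ∘ N_{L/K}` has Katz type `kΣ_L + κ_L(1 − c)`
  (`HeckeCharacter.HasInfinityType.compRelNorm_typeOfExponent`, Weil's "type of `χ ∘ N` =
  type of `χ` restricted along the embeddings").

References: [Hsieh2014mu] M.-L. Hsieh, J. reine angew. Math. 688 (2014), §1.1 (CM types, `Σ_p`);
[Katz1978] N. Katz, *`p`-adic `L`-functions for CM fields*, Invent. Math. 49 (1978), §5.1 (types
induced from a CM subfield); [Weil1956] §1.
-/

noncomputable section

open scoped NumberField Classical
open NumberField IsDedekindDomain NumberField.InfinitePlace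
open Literature.NumberTheory.GaloisRepresentations

namespace Literature.NumberTheory.GaloisRepresentations.PadicEmbedding

variable {K L : Type} [Field K] [NumberField K] [Field L] [NumberField L] [Algebra K L]
  {ℓ : ℕ} [Fact ℓ.Prime]

/-- **The place of a restricted `ℓ`-adic embedding is the restricted place**:
`v_{τ ∘ (K → L)} = v_τ ∩ 𝓞_K` (both ideals are `{d | ‖τ(d)‖ < 1}`; Neukirch: the valuation of `L`
defined by an embedding into `ℚ̄_ℓ` restricts to the valuation of `K` defined by the restricted
embedding). [cite: NeukirchANT1999, Ch. II (8.1)–(8.2) (extension and restriction of valuations along embeddings)] -/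
theorem place_comp_algebraMap_eq_under (τ : L →+* PadicAlgCl ℓ) :
    place (τ.comp (algebraMap K L)) = (place τ).under (𝓞 K) := by
  refine HeightOneSpectrum.ext ?_
  rw [HeightOneSpectrum.under_asIdeal]
  ext d
  change d ∈ ideal (τ.comp (algebraMap K L)) ↔ d ∈ (ideal τ).comap (algebraMap (𝓞 K) (𝓞 L))
  rw [Ideal.mem_comap, mem_ideal_iff, mem_ideal_iff, RingHom.comp_apply]
  have : ((algebraMap (𝓞 K) (𝓞 L) d : 𝓞 L) : L) = algebraMap K L (d : K) := by
    rw [RingOfIntegers.coe_eq_algebraMap, RingOfIntegers.coe_eq_algebraMap,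
      ← IsScalarTower.algebraMap_apply, ← IsScalarTower.algebraMap_apply]
  rw [this]

end Literature.NumberTheory.GaloisRepresentations.PadicEmbedding

namespace Literature.NumberTheory.EllipticCurves

namespace KatzCM

variable {K : Type} (L : Type) [Field K] [NumberField K] [Field L] [NumberField L] [Algebra K L]
  {p : ℕ} [Fact p.Prime]

/-- **`φ ∈ Σ_L ↔ φ|_K ∈ Σ` for the induced `p`-adic datum**: with `Σ_{p,L}` the full preimage of
`Σ_p`, an embedding `φ : L → ℂ` is in the induced type iff its restriction is in the type
(`PadicEmbedding.place_comp_algebraMap_eq_under`). [cite: Hsieh2014mu, §1.1] [cite: Katz1978, §5.1] -/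
theorem inSigma_comp_iff (ι : PadicAlgCl p ≃+* ℂ) {Sp : Finset (HeightOneSpectrum (𝓞 K))}
    {SpL : Finset (HeightOneSpectrum (𝓞 L))}
    (hSp : ∀ 𝔓 : HeightOneSpectrum (𝓞 L), 𝔓 ∈ SpL ↔ 𝔓.under (𝓞 K) ∈ Sp) (φ : L →+* ℂ) :
    InSigma ι SpL φ ↔ InSigma ι Sp (φ.comp (algebraMap K L)) := by
  unfold InSigma
  rw [hSp, ← PadicEmbedding.place_comp_algebraMap_eq_under]
  rfl

/-- **The induced exponent function is the pull-back**: for `κ_L(w) = κ(w|_K)` and `Σ_{p,L}` the full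
preimage of `Σ_p`, `katzExponent ι Σ_{p,L} k κ_L = (katzExponent ι Σ_p k κ) ∘ (φ ↦ φ|_K)`.
[cite: Hsieh2014mu, §1.1] [cite: Katz1978, §5.1] -/
theorem katzExponent_induced (ι : PadicAlgCl p ≃+* ℂ) {Sp : Finset (HeightOneSpectrum (𝓞 K))}
    {SpL : Finset (HeightOneSpectrum (𝓞 L))}
    (hSp : ∀ 𝔓 : HeightOneSpectrum (𝓞 L), 𝔓 ∈ SpL ↔ 𝔓.under (𝓞 K) ∈ Sp) (k : ℕ)
    (κ : InfinitePlace K → ℕ) :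
    katzExponent ι SpL k (fun w ↦ κ (w.comap (algebraMap K L))) =
      fun φ : L →+* ℂ ↦ katzExponent ι Sp k κ (φ.comp (algebraMap K L)) := by
  funext φ
  simp only [katzExponent, inSigma_comp_iff L ι hSp φ, ← comap_mk]

variable [IsGalois K L] [IsTotallyComplex K]

/-- **The Katz type of `χ ∘ N_{L/K}`.** For totally complex `K ⊆ L` (`L/K` Galois), if `χ` has
Katz type `kΣ + κ(1 − c)` for the `p`-adic datum `(ι, Σ_p)`, then `χ.compRelNorm L = χ ∘ N_{L/K}`
has Katz type `kΣ_L + κ_L(1 − c)` for the induced datum `(ι, Σ_{p,L})`, `Σ_{p,L}` the full preimage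
of `Σ_p` and `κ_L(w) = κ(w|_K)` — the shape of hypothesis (T) of the BSD V2 socket (Katz type of a
character base-changed from an imaginary quadratic field to the biquadratic CM field).
[cite: Katz1978, §5.1] [cite: Hsieh2014mu, §1.1] [cite: Weil1956, §1] -/
theorem HasKatzType.compRelNorm {ι : PadicAlgCl p ≃+* ℂ} {Sp : Finset (HeightOneSpectrum (𝓞 K))}
    {χ : HeckeCharacter K} {k : ℕ} {κ : InfinitePlace K → ℕ} (h : HasKatzType ι Sp χ k κ)
    {SpL : Finset (HeightOneSpectrum (𝓞 L))}
    (hSp : ∀ 𝔓 : HeightOneSpectrum (𝓞 L), 𝔓 ∈ SpL ↔ 𝔓.under (𝓞 K) ∈ Sp) :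
    HasKatzType ι SpL (χ.compRelNorm L) k (fun w ↦ κ (w.comap (algebraMap K L))) := by
  unfold HasKatzType
  rw [katzExponent_induced L ι hSp k κ]
  exact h.compRelNorm_typeOfExponent L (katzExponent ι Sp k κ)

/-! ### Algebra of Katz types: products with characters of type `δ(1 − c)` -/

section Algebra

variable {L : Type} [Field L] [NumberField L] {p : ℕ} [Fact p.Prime]

omit [NumberField L] in
/-- The type attached to a sum of exponent functions is the sum of the types.
[cite: Weil1956, §1 (types form a group under addition)] -/
theorem typeOfExponent_add (n m : (L →+* ℂ) → ℤ) :
    HeckeCharacter.typeOfExponent (n + m) =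
      ((HeckeCharacter.typeOfExponent n).1 + (HeckeCharacter.typeOfExponent m).1,
        (HeckeCharacter.typeOfExponent n).2 + (HeckeCharacter.typeOfExponent m).2) := by
  refine Prod.ext (funext fun w ↦ rfl) (funext fun w ↦ ?_)
  simp only [HeckeCharacter.typeOfExponent, Pi.add_apply]
  split_ifs <;> simp

/-- **Katz exponents add**: `(kΣ + κ(1−c)) + (0·Σ + δ(1−c)) = kΣ + (κ+δ)(1−c)` as exponent functions.
[cite: Hsieh2014mu, §1 (infinity types `kΣ + κ(1 − c)`)] -/
theorem katzExponent_add (ι : PadicAlgCl p ≃+* ℂ) (Sp : Finset (HeightOneSpectrum (𝓞 L))) (k : ℕ)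
    (κ δ : InfinitePlace L → ℕ) :
    katzExponent ι Sp k κ + katzExponent ι Sp 0 δ = katzExponent ι Sp k (κ + δ) := by
  funext φ
  simp only [katzExponent, Pi.add_apply, Nat.cast_zero, zero_add, Nat.cast_add]
  split_ifs <;> ring

/-- **Katz types multiply**: if `χ` has Katz type `kΣ + κ(1 − c)` and `ψ` has Katz type
`δ(1 − c)` (`k = 0`; e.g. an anticyclotomic character "of type `(δ, −δ)`"), then `χψ` has Katz type
`kΣ + (κ + δ)(1 − c)` — the shape `λ · χ∘N` of the Katz frame, `λ` of type `Σ + κ(1−c)` and `χ∘N`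
of type `δ(1 − c)`. [cite: Hsieh2014mu, §1, §4.1 (the characters `λ·χ` interpolated by the Katz measure)] -/
theorem HasKatzType.mul {ι : PadicAlgCl p ≃+* ℂ} {Sp : Finset (HeightOneSpectrum (𝓞 L))}
    {χ ψ : HeckeCharacter L} {k : ℕ} {κ δ : InfinitePlace L → ℕ}
    (hχ : HasKatzType ι Sp χ k κ) (hψ : HasKatzType ι Sp ψ 0 δ) :
    HasKatzType ι Sp (χ * ψ) k (κ + δ) := by
  unfold HasKatzType at hχ hψ ⊢
  have h := hχ.mul' hψ
  rw [← katzExponent_add, typeOfExponent_add]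
  exact h

/-- Symmetric form: `ψ` of type `δ(1 − c)` times `χ` of type `kΣ + κ(1 − c)`.
[cite: Hsieh2014mu, §1, §4.1] -/
theorem HasKatzType.mul_left {ι : PadicAlgCl p ≃+* ℂ} {Sp : Finset (HeightOneSpectrum (𝓞 L))}
    {χ ψ : HeckeCharacter L} {k : ℕ} {κ δ : InfinitePlace L → ℕ}
    (hψ : HasKatzType ι Sp ψ 0 δ) (hχ : HasKatzType ι Sp χ k κ) :
    HasKatzType ι Sp (ψ * χ) k (κ + δ) := by
  rw [mul_comm]; exact hχ.mul hψ

end Algebra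

end KatzCM

end Literature.NumberTheory.EllipticCurves

end
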